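import Summits.QuantumFields.YangMills.Theorems.UnitScaleTiltProp7TwistDefectOfRegPr
import Summits.QuantumFields.YangMills.Theorems.AlphaInputsT3ACv3NewtonLiftOneBlockCert
import HarnessLib

/-!
# Route `UnitScaleTilt`, crux K1 child «MinimiserStabilityRegPr» (stmt-QuantumFields-19200), stub `stub_existenceMinimalOrbit` (EX), route (α), node (46)∕M12 — **(T1) COMPOSED: THE `obLift`
# KERNEL CERTIFICATE AT A `RegPr` BACKGROUND WITH THE TWIST-EXACTNESS DEFECT `≤ 67584·ε₀·‖u‖`, k-UNIFORM** (one name for the (T1)-half of the covariant right-inverse row (hQR))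

Cell `ym3-torus`, width seat `ym-ust-19200-w4` (gen 2; ★w2-19200 g2 RULING EX-KNIT №1 2026-08-28 04:02Z (R1)(ii): «(hQR) `‖QSym U₀ (Rcov U₀ X) − X‖ ≤ ½‖X‖` by the triangle inequality from
(T1) [`…TwistDefectOfRegPr`: exactness defect of the twisted port, θ ≤ c·ε₀ k-uniform] + (T2) … each of you state the constant you deliver»).  THEOREMS ONLY (0 `def`, 0 `sorry`).
YM₃ on T³ is a ladder rung (R3), not the Clay problem; nothing here claims the stub, the crux, d = 4 or the mass gap.

WHAT.  ★w4-19936 g2's certificate `NewtonLiftFramed.exists_obLift_gaugeKernel` at the CENTRE-anchored comb gauges of the background, `σ_c := axialT U₀ (toFine (K−n) c₋)` (the convention of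
record: ★w5-19936's two-cell chart, frames `ψ_σ = Ad(σ_{c′}(b₋)⁻¹σ_{c′}^{(K−n)}(c′₋))` = transport from the block centre), with its (γ) binder `hosc` DISCHARGED by
`Prop7TwistDefectOfRegPr.osc_centreAxial_of_regPr` (`ω = 8ε₀`): for `U₀ ∈ 𝔘_k(ε₀)` (`RegPr F n K ε₀ U₀`), `n < K`, and the no-wrap margin `4L^{K−n} ≤ |T|`, there is an `ℝ`-linear
`R₀ : (PBond P (K−n) → M₂) → (PBond P 0 → M₂)` with (α) `𝔰𝔲(2)`-valuedness, (β) `‖R₀u‖ ≤ (1056∕L^{K−n})‖u‖`, and (γ′) for every coarse bond `c`: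
  `‖σ_c^{(K−n)}(c₋)^*·Q^{(K−n)}(b ↦ σ_c(b₋)(R₀u)_bσ_c(b₋)^*)(c)·σ_c^{(K−n)}(c₋) − u(c)‖ ≤ ((3+1)L^{K−n})·((1056∕L^{K−n})·(2·8ε₀·‖u‖)) = 67584·ε₀·‖u‖`
— the exactness defect of the twisted port in the `σ_c`-rotated flat-average currency, k-UNIFORM (`3 ≤ L^{K−n}` from `L` odd `> 1` and `n < K`, as `Prop7HSymObLift.three_le_pow_L`).  The (δ) curl row of the
certificate is the Newton-lift's and is not needed by (46); its flatness inputs are `Prop7TwistDefectOfRegPr.flat_centreAxial_of_regPr`.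

HONEST SCOPE.  Instantiation by `exact`; nothing of [Balaban1985Variational]∕[Balaban1985Averaging] is asserted; `--supports stmt-QuantumFields-19200`, count-neutral.

References: T. Bałaban, CMP 98 (1985) 17–51 [Balaban1985Averaging] ((11)–(13) p.19, (19) p.21, pp.24–25); CMP 102 (1985) 277–309 [Balaban1985Variational] ((6) p.278, (46) p.285).
-/

set_option autoImplicit false

noncomputable section

open scoped Matrix.Norms.L2Operator

namespace Summit.QuantumFields.YangMills.Theorems.Prop7TwistDefectOfRegPr

open Literature.MathematicalPhysics.QuantumFieldTheory.Balaban1983to89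
open Literature.MathematicalPhysics.QuantumFieldTheory.Balaban1983to89.T3ContinuumYM3Torus
open Literature.MathematicalPhysics.QuantumFieldTheory.Balaban1983to89.T3PrintedRegularMinimiser (RegPr)
open Literature.MathematicalPhysics.QuantumFieldTheory.Balaban1983to89.T3SectALandauChart (pos_of_regPr)
open Literature.MathematicalPhysics.QuantumFieldTheory.Balaban1983to89.T4AdjointCovarianceUnitary (lieSU)
open Literature.MathematicalPhysics.QuantumFieldTheory.Balaban1983to89.B10Eq38TorusDomains (toFine)
open B10Eq27TorusAxialLog (axialT)
open T4Continuum
open Summit.QuantumFields.YangMills.Theorems.LinearLiftMatrix (linAvgIterM)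
open Summit.QuantumFields.YangMills.Theorems.NewtonLiftFramed (exists_obLift_gaugeKernel)

variable (F : T3Family) {n K : ℕ}

/-- ★★ **THE `obLift` CERTIFICATE AT A `RegPr` BACKGROUND, (γ) DISCHARGED WITH `ω = 8ε₀`** — (α) `𝔰𝔲(2)`-valuedness, (β) `‖R₀u‖ ≤ (1056∕L^{K−n})‖u‖`, (γ′) the twisted-port exactness
defect `≤ 67584·ε₀·‖u‖` for the centre-anchored comb gauges `fun c ↦ axialT U₀ (toFine (K − n) c.src)`; k-UNIFORM.  The (T1)-half of (hQR).
[cite: Balaban1985Averaging, (11)-(13) p.19, (19) p.21, pp.24-25; Balaban1985Variational, (6) p.278, (46) p.285] -/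
theorem exists_obLift_gaugeKernel_of_regPr (hnK : n < K) {ε₀ : ℝ} {U₀ : GaugeField (F.P K) 0 (Matrix.specialUnitaryGroup (Fin 2) ℂ)} (hreg : RegPr F n K ε₀ U₀)
    (hN4 : 4 * (F.P K).L ^ (K - n) ≤ (F.P K).sitesPerDir 0) :
    ∃ R₀ : (PBond (F.P K) (K - n) → Matrix (Fin 2) (Fin 2) ℂ) →ₗ[ℝ] (PBond (F.P K) 0 → Matrix (Fin 2) (Fin 2) ℂ),
      (∀ u : PBond (F.P K) (K - n) → Matrix (Fin 2) (Fin 2) ℂ, (∀ c, u c ∈ lieSU (Fin 2)) → ∀ b, R₀ u b ∈ lieSU (Fin 2)) ∧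
      (∀ u : PBond (F.P K) (K - n) → Matrix (Fin 2) (Fin 2) ℂ, ‖R₀ u‖ ≤ (1056 / (F.L : ℝ) ^ (K - n)) * ‖u‖) ∧
      (∀ (c : PBond (F.P K) (K - n)) (u : PBond (F.P K) (K - n) → Matrix (Fin 2) (Fin 2) ℂ),
        ‖star (transfUp (axialT U₀ (toFine (K - n) c.src)) (K - n) c.src : Matrix (Fin 2) (Fin 2) ℂ) *
              linAvgIterM (K - n) (fun b => ((axialT U₀ (toFine (K - n) c.src) b.src : Matrix.specialUnitaryGroup (Fin 2) ℂ) : Matrix (Fin 2) (Fin 2) ℂ) * R₀ u b *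
                star ((axialT U₀ (toFine (K - n) c.src) b.src : Matrix.specialUnitaryGroup (Fin 2) ℂ) : Matrix (Fin 2) (Fin 2) ℂ)) c *
              (transfUp (axialT U₀ (toFine (K - n) c.src)) (K - n) c.src : Matrix (Fin 2) (Fin 2) ℂ) - u c‖ ≤
          67584 * ε₀ * ‖u‖) := by
  have hε₀ : 0 ≤ ε₀ := (pos_of_regPr F hreg).le
  -- `3 ≤ L^{K−n}` (`L` odd `> 1`, `n < K`; = `Prop7HSymObLift.three_le_pow_L`, inlined to keep the imports light)
  have hn3 : 3 ≤ F.L ^ (K - n) := by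
    have hL3 : 3 ≤ F.L := by
      obtain ⟨m, hm⟩ := F.hL.1
      have := F.hL.2
      omega
    calc 3 ≤ F.L := hL3
      _ = F.L ^ 1 := (pow_one _).symm
      _ ≤ F.L ^ (K - n) := Nat.pow_le_pow_right (by omega) (by omega)
  obtain ⟨R₀, hα, hβ, hγ, -⟩ := exists_obLift_gaugeKernel (n := Fin 2) (F := F) (K := K) (k := K - n) (Nat.sub_le K n) hn3
    (fun c => axialT U₀ (toFine (K - n) c.src))
  refine ⟨R₀, hα, hβ, fun c u => ?_⟩
  have h := hγ c u (8 * ε₀) (by positivity) (fun b hb1 hb2 c' hc' => osc_centreAxial_of_regPr F hreg hN4 c b hb1 hb2 c' hc')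
  have hL : (0 : ℝ) < (F.L : ℝ) ^ (K - n) := by
    have : (0 : ℝ) < F.L := by have := F.hL.2; exact_mod_cast (by omega : 0 < F.L)
    positivity
  have hd : (((F.P K).d : ℕ) : ℝ) = 3 := by rw [T3Family.P_d]; norm_num
  have e : ((((F.P K).d : ℝ) + 1) * (F.L : ℝ) ^ (K - n)) * ((1056 / (F.L : ℝ) ^ (K - n)) * ((2 * (8 * ε₀)) * ‖u‖)) = 67584 * ε₀ * ‖u‖ := by
    rw [hd]; field_simp; ring
  rw [e] at h
  exact h

end Summit.QuantumFields.YangMills.Theorems.Prop7TwistDefectOfRegPr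

end
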